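import Mathlib.Algebra.Order.Chebyshev
import Mathlib.LinearAlgebra.Matrix.Hadamard
import Summits.ValiantsHypothesis.ValiantsHypothesis.Theorems.SliceSignRankSrkNotQPForsterSliceBalanced
import Summits.ValiantsHypothesis.ValiantsHypothesis.Theorems.SliceSignRankSignRankSuperQPVdwHadamard

/-!
# Route SliceSignRank — crux `SrkNotQP` (stmt-ValiantsHypothesis-20857), line `forster_slice`:
# Forster's inequality for the permutation slice holds VERBATIM for ISOTROPIC representations

The registered stub `stub_forsterSlice` of `Cruxes/SrkNotQP/Lines/forster_slice.lean` (the bet of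
the line) asks: whenever `F(σ) = Σ_{t<k} φ_t(σ)`, `φ_t(σ) = Π_i W_t(σ i, i)`, sign-represents `sgn`
on `S_n`, some real twist `V` has `det V ≠ 0` and `n! · per(V ∘ V) ≤ k^C · det(V)²`.

Forster's theorem (sign-rank of an `N × N` sign matrix `M` is `≥ N/‖M‖`; Forster 2002, Thm 2.2) is
proved in two steps: (L) a `GL_k`-LEMMA bringing the realising vectors into ISOTROPIC POSITION
(`Σ_x u_x u_xᵀ = (N/k)·I`, all `u_x, v_y` unit), and (V) a three-line VERBATIM estimate that uses
only two consequences of (L): the coordinate rank-one terms `a⁽ⁱ⁾ ⊗ b⁽ⁱ⁾` of `A = (⟨u_x, v_y⟩)` are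
Frobenius-ORTHOGONAL (`Σ_i ‖a⁽ⁱ⁾ ⊗ b⁽ⁱ⁾‖² = ‖A‖²`, "isotropy"), and `|A_xy| ≤ 1` while the mean
square of `A` is `1/k` ("flatness", `N² · max A² ≤ k · ‖A‖²`).  This file proves step (V) for the
slice, with the two consequences as typed hypotheses carrying constants `B` (isotropy defect) and
`B'` (flatness defect):

* (I1) `Σ_t per(W_t ∘ W_t) ≤ B · Σ_σ F(σ)²` — the Gram matrix `G_st = ⟨φ_s, φ_t⟩ = per(W_s ⊙ W_t)`
  (`sum_prod_mul_prod_eq_permanent_hadamard`) has `tr G ≤ B · 1ᵀG1`; orthogonal terms give `B = 1`;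
* (I2) `n! · F(σ)² ≤ B' · Σ_τ F(τ)²` for every `σ` — sup square at most `B'` times mean square.

THEOREM (`forsterSlice_of_isotropic`): under (I1), (I2) some term `V = W_t` of the representation
has `det V ≠ 0` and `n! · per(V ∘ V) ≤ B · B' · k · det(V)²`.  In Forster's matrix dictionary
(`B = 1`, `B' = k`) this is `N²‖a ⊗ b‖² ≤ k² ⟨M, a ⊗ b⟩²`, i.e. `‖M‖ ≥ ⟨M, a⊗b⟩/(‖a‖‖b‖) ≥ N/k` —
exactly Forster's bound with his exponent `C = 2`; on the slice it is TIGHT at the Leibniz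
representation (`k = n!`, `W_τ` = signed permutation matrices: orthogonal, `|F| ≡ 1`, `B = B' = 1`,
`n! · 1 = n! · 1`) and at `n = 2, k = 1` (Hadamard twist).  Proof = Forster's three lines:
`Σ_σ F² ≤ max|F| · Σ_σ |F| = max|F| · Σ_t det W_t` (`sum_sq_le_mul_sum_det`, the slice form of
`Σ⟨u,v⟩² ≤ Σ|⟨u,v⟩|`, using p1's dictionary `Σ_σ |F| = Σ_t det W_t`), Cauchy–Schwarz over the `k`
terms, and (I1) to pass from `‖F‖²` to the individual `‖φ_t‖² = per(W_t ∘ W_t)`; a ratio-of-sums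
step then picks the twist.

COROLLARIES: `forsterSlice_of_orthogonal` (`B = 1`); `forsterSlice_of_isotropic_pow` (the stub's
literal conclusion `∃ V, det V ≠ 0 ∧ n!·per(V∘V) ≤ k^(a+b+1)·det(V)²` when `B ≤ k^a`, `B' ≤ k^b`);
`forsterSlice_of_gauge_isotropic` (the slice's only Forster-type symmetry — a positive entrywise
gauge `W_t ↦ c ⊙ W_t`, which multiplies `F` by the positive slice function `Π_i c(σ i, i)` and so
preserves sign-representation, `signRep_hadamard_of_pos` — may be applied first; the missing
"slice Forster lemma" is precisely: reach poly(k) constants `B, B'` by such a gauge or by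
re-representation); and,
with the landed van der Waerden–Hadamard inequality (`stub_vdwHadamard`, p558422),
`factorial_sq_le_of_isotropic_signRep`: **every (B, B')-isotropic sign-representation of `sgn` on
`S_n` has `k · B · B' ≥ (n!)²/nⁿ`** — isotropic representations are exponentially long, an
unconditional lower bound for this restricted model.

HONEST CALIBRATION.  This is a SURROGATE, not the stub: a short representation may be far from
isotropic (large L²-cancellation between terms, `B ≫ 1`, or a spiky `F`, `B' ≫ 1`), and no analogue
of Forster's Lemma (L) is known for the slice.  By p1's kernel equivalence
(`forsterSlice_iff_factorialPowerLower`) the stub is the exponential statement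
`srk(n) ≥ (n!)^{Ω(1)}`; this file shows it would follow from "optimal representations can be made
poly(k)-isotropic", and conversely that if `srk(n) = 2^{O(n)}` then optimal representations have
`B·B' ≥ (n!)^{2-o(1)}/k`.
The stub, the crux `SrkNotQP`, `SignRankSuperQP` remain OPEN; `VP ≠ VNP` is not touched.  Landed
`--supports stmt-ValiantsHypothesis-20857` (companion of p1's pointwise-balanced surrogate
`forsterSlice_of_balanced`, whose hypotheses imply (I1), (I2) with `B ↦ kB²`, `B' ↦ B²`).

References: [Forster2002] J. Forster, *A linear lower bound on the unbounded error probabilistic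
communication complexity*, JCSS 65 (2002) 612–625, Thm 2.2 (proof as in Jukna, *Boolean Function
Complexity* (2012), Thm 4.42); [RazborovSherstov2010] §1.
-/

-- Sub = Summit layout duplicates the namespace component
set_option linter.dupNamespace false

namespace Summit.ValiantsHypothesis.ValiantsHypothesis.Theorems.SliceSignRank.SrkNotQP

open Finset Equiv
open scoped Matrix

/-! ## §1 The Gram dictionary: inner products of monomial slice functions are permanents -/

/-- **Gram entries are permanents of Hadamard products**:
`Σ_σ (Π_i V(σ i, i)) · (Π_i W(σ i, i)) = per(V ⊙ W)`.  With `V = W` this is p1's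
`sum_prod_sq_eq_permanent`. [folklore] -/
theorem sum_prod_mul_prod_eq_permanent_hadamard {n : ℕ} (V W : Matrix (Fin n) (Fin n) ℝ) :
    ∑ σ : Perm (Fin n), (∏ i, V (σ i) i) * (∏ i, W (σ i) i) = (V ⊙ W).permanent := by
  unfold Matrix.permanent
  refine Finset.sum_congr rfl fun σ _ => ?_
  rw [← Finset.prod_mul_distrib]
  rfl

/-- The entrywise square written as a Hadamard square: `per(W ⊙ W) = per(W ∘ W)`. [folklore] -/
theorem permanent_hadamard_self_eq {n : ℕ} (W : Matrix (Fin n) (Fin n) ℝ) :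
    (W ⊙ W).permanent = (Matrix.of fun i j => W i j ^ 2).permanent := by
  congr 1
  ext i j
  simp [sq]

/-- **`‖F‖²` is the total Gram mass**: for `F(σ) = Σ_t Π_i W_t(σ i, i)`,
`Σ_σ F(σ)² = Σ_s Σ_t per(W_s ⊙ W_t)`. [folklore] -/
theorem sum_sq_eq_sum_permanent_hadamard {n k : ℕ} (W : Fin k → Matrix (Fin n) (Fin n) ℝ) :
    ∑ σ : Perm (Fin n), (∑ t, ∏ i, W t (σ i) i) ^ 2 =
      ∑ s, ∑ t, (W s ⊙ W t).permanent := by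
  calc ∑ σ : Perm (Fin n), (∑ t, ∏ i, W t (σ i) i) ^ 2
      = ∑ σ : Perm (Fin n), ∑ s, ∑ t, (∏ i, W s (σ i) i) * (∏ i, W t (σ i) i) := by
        refine Finset.sum_congr rfl fun σ _ => ?_
        rw [sq, Finset.sum_mul_sum]
    _ = ∑ s, ∑ σ : Perm (Fin n), ∑ t, (∏ i, W s (σ i) i) * (∏ i, W t (σ i) i) := Finset.sum_comm
    _ = ∑ s, ∑ t, ∑ σ : Perm (Fin n), (∏ i, W s (σ i) i) * (∏ i, W t (σ i) i) :=
        Finset.sum_congr rfl fun s _ => Finset.sum_comm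
    _ = ∑ s, ∑ t, (W s ⊙ W t).permanent :=
        Finset.sum_congr rfl fun s _ => Finset.sum_congr rfl fun t _ =>
          sum_prod_mul_prod_eq_permanent_hadamard (W s) (W t)

/-- The permanent of an entrywise square is nonnegative (it is `Σ_σ φ_W(σ)²`). [folklore] -/
theorem permanent_sq_nonneg {n : ℕ} (W : Matrix (Fin n) (Fin n) ℝ) :
    0 ≤ (Matrix.of fun i j => W i j ^ 2).permanent := by
  rw [← sum_prod_sq_eq_permanent W]
  exact Finset.sum_nonneg fun σ _ => sq_nonneg _

/-! ## §2 Forster's two estimates on the slice -/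

/-- **Forster's first estimate, slice form** (`Σ ⟨u,v⟩² ≤ Σ |⟨u,v⟩|` when `|⟨u,v⟩| ≤ 1`):
if `F` sign-represents `sgn` and `|F| ≤ M` pointwise then `Σ_σ F(σ)² ≤ M · Σ_t det(W_t)`
(the total mass `Σ_σ |F(σ)|` is `Σ_t det W_t`, p1's `sum_abs_eq_sum_det`).
[pattern of Forster2002 Thm 2.2] -/
theorem sum_sq_le_mul_sum_det {n k : ℕ} (W : Fin k → Matrix (Fin n) (Fin n) ℝ) (M : ℝ)
    (hrep : ∀ σ : Perm (Fin n), 0 < ((Perm.sign σ : ℤ) : ℝ) * ∑ t, ∏ i, W t (σ i) i)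
    (hM : ∀ σ : Perm (Fin n), |∑ t, ∏ i, W t (σ i) i| ≤ M) :
    ∑ σ : Perm (Fin n), (∑ t, ∏ i, W t (σ i) i) ^ 2 ≤ M * ∑ t, (W t).det := by
  rw [← sum_abs_eq_sum_det W hrep, Finset.mul_sum]
  refine Finset.sum_le_sum fun σ _ => ?_
  have h0 : 0 ≤ |∑ t, ∏ i, W t (σ i) i| := abs_nonneg _
  calc (∑ t, ∏ i, W t (σ i) i) ^ 2 = |∑ t, ∏ i, W t (σ i) i| * |∑ t, ∏ i, W t (σ i) i| := by
        rw [← sq_abs, sq]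
    _ ≤ M * |∑ t, ∏ i, W t (σ i) i| := mul_le_mul_of_nonneg_right (hM σ) h0

/-- **Forster's second estimate, slice form** (Cauchy–Schwarz over the `k` hidden coordinates):
`(Σ_t det W_t)² ≤ k · Σ_t det(W_t)²`. [folklore] -/
theorem sq_sum_det_le {n k : ℕ} (W : Fin k → Matrix (Fin n) (Fin n) ℝ) :
    (∑ t, (W t).det) ^ 2 ≤ (k : ℝ) * ∑ t, (W t).det ^ 2 := by
  have h := sq_sum_le_card_mul_sum_sq (s := (Finset.univ : Finset (Fin k)))
    (f := fun t => (W t).det)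
  simpa [Finset.card_univ, Fintype.card_fin] using h

/-- A sign-representation has positive `L²` mass: `0 < Σ_σ F(σ)²` (the identity permutation has
`F(1) > 0`). [folklore] -/
theorem sum_sq_pos_of_signRep {n k : ℕ} (W : Fin k → Matrix (Fin n) (Fin n) ℝ)
    (hrep : ∀ σ : Perm (Fin n), 0 < ((Perm.sign σ : ℤ) : ℝ) * ∑ t, ∏ i, W t (σ i) i) :
    0 < ∑ σ : Perm (Fin n), (∑ t, ∏ i, W t (σ i) i) ^ 2 := by
  have h1 : 0 < (∑ t, ∏ i, W t ((1 : Perm (Fin n)) i) i) ^ 2 := by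
    have h := hrep 1
    simp only [Perm.sign_one, Units.val_one, Int.cast_one, one_mul] at h
    positivity
  exact lt_of_lt_of_le h1 (Finset.single_le_sum
    (f := fun σ : Perm (Fin n) => (∑ t, ∏ i, W t (σ i) i) ^ 2) (fun σ _ => sq_nonneg _)
    (Finset.mem_univ (1 : Perm (Fin n))))

/-- The isotropy defect of a sign-representation is nonnegative: `0 ≤ Σ_t per(W_t ∘ W_t) ≤ B · ‖F‖²`
with `‖F‖² > 0` forces `0 ≤ B`. [this file] -/
theorem isoDefect_nonneg {n k : ℕ} (W : Fin k → Matrix (Fin n) (Fin n) ℝ) (B : ℝ)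
    (hrep : ∀ σ : Perm (Fin n), 0 < ((Perm.sign σ : ℤ) : ℝ) * ∑ t, ∏ i, W t (σ i) i)
    (hiso : ∑ t, (Matrix.of fun i j => W t i j ^ 2).permanent ≤
      B * ∑ σ : Perm (Fin n), (∑ t, ∏ i, W t (σ i) i) ^ 2) : 0 ≤ B := by
  have hPnn : 0 ≤ ∑ t, (Matrix.of fun i j => W t i j ^ 2).permanent :=
    Finset.sum_nonneg fun t _ => permanent_sq_nonneg (W t)
  refine le_of_mul_le_mul_right ?_ (sum_sq_pos_of_signRep W hrep)
  rw [zero_mul]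
  exact hPnn.trans hiso

/-- The flatness defect of a sign-representation is positive: `0 < n! · F(1)² ≤ B' · ‖F‖²`
forces `0 < B'`. [this file] -/
theorem flatDefect_pos {n k : ℕ} (W : Fin k → Matrix (Fin n) (Fin n) ℝ) (B' : ℝ)
    (hrep : ∀ σ : Perm (Fin n), 0 < ((Perm.sign σ : ℤ) : ℝ) * ∑ t, ∏ i, W t (σ i) i)
    (hflat : ∀ σ : Perm (Fin n), (n.factorial : ℝ) * (∑ t, ∏ i, W t (σ i) i) ^ 2 ≤
      B' * ∑ τ : Perm (Fin n), (∑ t, ∏ i, W t (τ i) i) ^ 2) : 0 < B' := by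
  have h1 : 0 < (n.factorial : ℝ) * (∑ t, ∏ i, W t ((1 : Perm (Fin n)) i) i) ^ 2 := by
    have h0 := hrep 1
    simp only [Perm.sign_one, Units.val_one, Int.cast_one, one_mul] at h0
    have hfac : (0 : ℝ) < n.factorial := by exact_mod_cast Nat.factorial_pos n
    positivity
  refine lt_of_mul_lt_mul_right ?_ (sum_sq_pos_of_signRep W hrep).le
  rw [zero_mul]
  exact lt_of_lt_of_le h1 (hflat 1)

/-! ## §3 Forster's inequality for the slice in isotropic position -/

/-- **Forster's inequality for the permutation slice — ISOTROPIC representations (Forster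
verbatim).**
Let `F(σ) = Σ_{t<k} Π_i W_t(σ i, i)` sign-represent `sgn` on `S_n`.  Assume
(I1, isotropy defect `B`) `Σ_t per(W_t ∘ W_t) ≤ B · Σ_σ F(σ)²` — the squared norms of the terms add
up to at most `B` times `‖F‖²` (exactly orthogonal terms: `B = 1`); and
(I2, flatness defect `B'`) `n! · F(σ)² ≤ B' · Σ_τ F(τ)²` for every `σ`.
Then some TERM `W_t` of the representation has `det W_t ≠ 0` and
`n! · per(W_t ∘ W_t) ≤ B · B' · k · det(W_t)²`.
In Forster's matrix setting `(B, B') = (1, k)` and this is his bound `k ≥ N/‖M‖` (exponent `C = 2`);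
tight on the slice at the Leibniz representation (`k = n!`) and at `n = 2, k = 1`.
The general stub (no isotropy hypotheses) remains OPEN.
[this file; pattern of Forster2002 Thm 2.2] -/
theorem forsterSlice_of_isotropic (n k : ℕ) (W : Fin k → Matrix (Fin n) (Fin n) ℝ) (B B' : ℝ)
    (hrep : ∀ σ : Perm (Fin n), 0 < ((Perm.sign σ : ℤ) : ℝ) * ∑ t, ∏ i, W t (σ i) i)
    (hiso : ∑ t, (Matrix.of fun i j => W t i j ^ 2).permanent ≤
      B * ∑ σ : Perm (Fin n), (∑ t, ∏ i, W t (σ i) i) ^ 2)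
    (hflat : ∀ σ : Perm (Fin n), (n.factorial : ℝ) * (∑ t, ∏ i, W t (σ i) i) ^ 2 ≤
      B' * ∑ τ : Perm (Fin n), (∑ t, ∏ i, W t (τ i) i) ^ 2) :
    ∃ t : Fin k, (W t).det ≠ 0 ∧
      (n.factorial : ℝ) * (Matrix.of fun i j => W t i j ^ 2).permanent ≤
        B * B' * (k : ℝ) * (W t).det ^ 2 := by
  -- abbreviations
  set F : Perm (Fin n) → ℝ := fun σ => ∑ t, ∏ i, W t (σ i) i with hF
  set S2 : ℝ := ∑ σ : Perm (Fin n), (F σ) ^ 2 with hS2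
  set D : ℝ := ∑ t, (W t).det with hD
  set Q : ℝ := ∑ t, (W t).det ^ 2 with hQ
  set P : ℝ := ∑ t, (Matrix.of fun i j => W t i j ^ 2).permanent with hP
  have hS2pos : 0 < S2 := sum_sq_pos_of_signRep W hrep
  have hfac : (0 : ℝ) < n.factorial := by exact_mod_cast Nat.factorial_pos n
  have hB : 0 ≤ B := isoDefect_nonneg W B hrep hiso
  have hB' : 0 ≤ B' := (flatDefect_pos W B' hrep hflat).le
  -- a maximiser `σ*` of `|F|`, `M = |F σ*|`
  obtain ⟨σm, -, hσm⟩ := Finset.exists_max_image Finset.univ (fun σ => |F σ|)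
    (Finset.univ_nonempty_iff.mpr ⟨(1 : Perm (Fin n))⟩)
  set M : ℝ := |F σm| with hM
  have hMle : ∀ σ, |F σ| ≤ M := fun σ => hσm σ (Finset.mem_univ σ)
  -- Forster 1: `S2 ≤ M · D`
  have h1 : S2 ≤ M * D := sum_sq_le_mul_sum_det W M hrep hMle
  -- flatness at the maximiser: `n! · M² ≤ B' · S2`
  have h2 : (n.factorial : ℝ) * M ^ 2 ≤ B' * S2 := by
    have := hflat σm
    rwa [hM, sq_abs]
  -- `n! · S2² ≤ n! M² D² ≤ B' S2 D²`, cancel `S2 > 0`: `n! · S2 ≤ B' · D²`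
  have h3 : (n.factorial : ℝ) * S2 ≤ B' * D ^ 2 := by
    have hsq : S2 ^ 2 ≤ (M * D) ^ 2 := pow_le_pow_left₀ hS2pos.le h1 2
    have h4 : (n.factorial : ℝ) * S2 ^ 2 ≤ B' * S2 * D ^ 2 :=
      calc (n.factorial : ℝ) * S2 ^ 2 ≤ (n.factorial : ℝ) * (M * D) ^ 2 :=
            mul_le_mul_of_nonneg_left hsq hfac.le
        _ = ((n.factorial : ℝ) * M ^ 2) * D ^ 2 := by ring
        _ ≤ (B' * S2) * D ^ 2 := mul_le_mul_of_nonneg_right h2 (sq_nonneg _)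
        _ = B' * S2 * D ^ 2 := by ring
    have h5 : S2 * ((n.factorial : ℝ) * S2) ≤ S2 * (B' * D ^ 2) := by
      calc S2 * ((n.factorial : ℝ) * S2) = (n.factorial : ℝ) * S2 ^ 2 := by ring
        _ ≤ B' * S2 * D ^ 2 := h4
        _ = S2 * (B' * D ^ 2) := by ring
    exact le_of_mul_le_mul_left h5 hS2pos
  -- Forster 2 (Cauchy–Schwarz): `D² ≤ k · Q`
  have h6 : D ^ 2 ≤ (k : ℝ) * Q := sq_sum_det_le W
  -- the summed inequality: `n! · P ≤ B · B' · k · Q`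
  have h7 : (n.factorial : ℝ) * P ≤ B * B' * (k : ℝ) * Q :=
    calc (n.factorial : ℝ) * P ≤ (n.factorial : ℝ) * (B * S2) :=
          mul_le_mul_of_nonneg_left hiso hfac.le
      _ = B * ((n.factorial : ℝ) * S2) := by ring
      _ ≤ B * (B' * D ^ 2) := mul_le_mul_of_nonneg_left h3 hB
      _ ≤ B * (B' * ((k : ℝ) * Q)) :=
          mul_le_mul_of_nonneg_left (mul_le_mul_of_nonneg_left h6 hB') hB
      _ = B * B' * (k : ℝ) * Q := by ring
  -- restrict to the twists with nonzero determinant and pick one by ratio of sums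
  set T : Finset (Fin k) := Finset.univ.filter (fun t => (W t).det ≠ 0) with hT
  obtain ⟨t₀, -, hdet₀⟩ := exists_det_ge_of_signRep W hrep
  have hTne : T.Nonempty := ⟨t₀, by simp [hT, hdet₀.ne']⟩
  have hsumQ : ∑ t ∈ T, B * B' * (k : ℝ) * (W t).det ^ 2 = B * B' * (k : ℝ) * Q := by
    rw [hQ, Finset.mul_sum]
    refine Finset.sum_filter_of_ne fun t _ ht => ?_
    intro hdet
    apply ht
    simp [hdet]
  have hsumP : ∑ t ∈ T, (n.factorial : ℝ) * (Matrix.of fun i j => W t i j ^ 2).permanent ≤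
      (n.factorial : ℝ) * P := by
    rw [hP, Finset.mul_sum]
    exact Finset.sum_le_sum_of_subset_of_nonneg (Finset.filter_subset _ _)
      fun t _ _ => mul_nonneg hfac.le (permanent_sq_nonneg (W t))
  have hle : ∑ t ∈ T, (n.factorial : ℝ) * (Matrix.of fun i j => W t i j ^ 2).permanent ≤
      ∑ t ∈ T, B * B' * (k : ℝ) * (W t).det ^ 2 := by
    rw [hsumQ]; exact hsumP.trans h7
  obtain ⟨t, htT, ht⟩ := Finset.exists_le_of_sum_le hTne hle
  have hdet : (W t).det ≠ 0 := (Finset.mem_filter.mp htT).2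
  exact ⟨t, hdet, ht⟩

/-- **Exactly orthogonal terms** (`per(W_s ⊙ W_t) = 0` for `s ≠ t`, Forster's isotropic position on
the nose): then (I1) holds with `B = 1` and the inequality reads
`n! · per(W_t ∘ W_t) ≤ B' · k · det(W_t)²`. [this file] -/
theorem forsterSlice_of_orthogonal (n k : ℕ) (W : Fin k → Matrix (Fin n) (Fin n) ℝ) (B' : ℝ)
    (hrep : ∀ σ : Perm (Fin n), 0 < ((Perm.sign σ : ℤ) : ℝ) * ∑ t, ∏ i, W t (σ i) i)
    (horth : ∀ s t : Fin k, s ≠ t → (W s ⊙ W t).permanent = 0)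
    (hflat : ∀ σ : Perm (Fin n), (n.factorial : ℝ) * (∑ t, ∏ i, W t (σ i) i) ^ 2 ≤
      B' * ∑ τ : Perm (Fin n), (∑ t, ∏ i, W t (τ i) i) ^ 2) :
    ∃ t : Fin k, (W t).det ≠ 0 ∧
      (n.factorial : ℝ) * (Matrix.of fun i j => W t i j ^ 2).permanent ≤
        B' * (k : ℝ) * (W t).det ^ 2 := by
  have hiso : ∑ t, (Matrix.of fun i j => W t i j ^ 2).permanent ≤
      1 * ∑ σ : Perm (Fin n), (∑ t, ∏ i, W t (σ i) i) ^ 2 := by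
    rw [one_mul, sum_sq_eq_sum_permanent_hadamard W]
    refine le_of_eq (Finset.sum_congr rfl fun s _ => ?_)
    rw [Finset.sum_eq_single s (fun t _ hts => horth s t (Ne.symm hts)) (by simp),
      permanent_hadamard_self_eq]
  obtain ⟨t, hdet, ht⟩ := forsterSlice_of_isotropic n k W 1 B' hrep hiso hflat
  exact ⟨t, hdet, by simpa using ht⟩

/-- **Polynomial defects give the stub's shape**: if the isotropy and flatness defects are
polynomial in `k` (`B ≤ k^a`, `B' ≤ k^b`), then
`∃ V, det V ≠ 0 ∧ n! · per(V ∘ V) ≤ k^(a+b+1) · det(V)²` — the conclusion of `stub_forsterSlice`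
with exponent `C = a + b + 1` (Forster: `a = 0, b = 1`, `C = 2`). [this file] -/
theorem forsterSlice_of_isotropic_pow (n k a b : ℕ) (W : Fin k → Matrix (Fin n) (Fin n) ℝ)
    (B B' : ℝ) (hBk : B ≤ (k : ℝ) ^ a) (hB'k : B' ≤ (k : ℝ) ^ b)
    (hrep : ∀ σ : Perm (Fin n), 0 < ((Perm.sign σ : ℤ) : ℝ) * ∑ t, ∏ i, W t (σ i) i)
    (hiso : ∑ t, (Matrix.of fun i j => W t i j ^ 2).permanent ≤
      B * ∑ σ : Perm (Fin n), (∑ t, ∏ i, W t (σ i) i) ^ 2)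
    (hflat : ∀ σ : Perm (Fin n), (n.factorial : ℝ) * (∑ t, ∏ i, W t (σ i) i) ^ 2 ≤
      B' * ∑ τ : Perm (Fin n), (∑ t, ∏ i, W t (τ i) i) ^ 2) :
    ∃ V : Matrix (Fin n) (Fin n) ℝ, V.det ≠ 0 ∧
      (n.factorial : ℝ) * (Matrix.of fun i j => V i j ^ 2).permanent ≤
        (k : ℝ) ^ (a + b + 1) * V.det ^ 2 := by
  obtain ⟨t, hdet, ht⟩ := forsterSlice_of_isotropic n k W B B' hrep hiso hflat
  refine ⟨W t, hdet, ht.trans ?_⟩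
  -- the product bound `B · B' · k ≤ k^a · k^b · k` (needs `0 ≤ B`, `0 ≤ B'`, forced by (I1), (I2))
  have hB : 0 ≤ B := isoDefect_nonneg W B hrep hiso
  have hB' : 0 ≤ B' := (flatDefect_pos W B' hrep hflat).le
  have hk0 : (0 : ℝ) ≤ k := Nat.cast_nonneg k
  have hprod : B * B' * (k : ℝ) ≤ (k : ℝ) ^ (a + b + 1) := by
    calc B * B' * (k : ℝ) ≤ (k : ℝ) ^ a * (k : ℝ) ^ b * (k : ℝ) := by gcongr
      _ = (k : ℝ) ^ (a + b + 1) := by ring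
  exact mul_le_mul_of_nonneg_right hprod (sq_nonneg _)

/-! ## §4 The positive gauge (the slice's Forster-type symmetry) -/

/-- **A positive entrywise gauge preserves sign-representation**: if `c(a, i) > 0` for all `a, i`,
then `Σ_t Π_i (c ⊙ W_t)(σ i, i) = (Π_i c(σ i, i)) · F(σ)` has the sign of `F(σ)`; so the gauged
family `(c ⊙ W_t)_t` sign-represents `sgn` whenever `(W_t)_t` does.  (This torus
`(ℝ_{>0})^{n×n}` — acting on `F` by the positive slice functions `σ ↦ Π_i c(σ i, i)` — is the only
symmetry of the model of Forster's rescaling type; there is no `GL_k` mixing of the terms.)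
[folklore] -/
theorem signRep_hadamard_of_pos {n k : ℕ} (W : Fin k → Matrix (Fin n) (Fin n) ℝ)
    (c : Matrix (Fin n) (Fin n) ℝ) (hc : ∀ a i, 0 < c a i)
    (hrep : ∀ σ : Perm (Fin n), 0 < ((Perm.sign σ : ℤ) : ℝ) * ∑ t, ∏ i, W t (σ i) i) :
    ∀ σ : Perm (Fin n), 0 < ((Perm.sign σ : ℤ) : ℝ) * ∑ t, ∏ i, (c ⊙ W t) (σ i) i := by
  intro σ
  have hC : 0 < ∏ i, c (σ i) i := Finset.prod_pos fun i _ => hc (σ i) i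
  have hsum : ∑ t, ∏ i, (c ⊙ W t) (σ i) i = (∏ i, c (σ i) i) * ∑ t, ∏ i, W t (σ i) i := by
    rw [Finset.mul_sum]
    refine Finset.sum_congr rfl fun t _ => ?_
    rw [← Finset.prod_mul_distrib]
    rfl
  rw [hsum, mul_left_comm]
  exact mul_pos hC (hrep σ)

/-- **Forster's inequality for the slice after a positive gauge.**  If some positive gauge `c`
brings the representation into `(B, B')`-isotropic position (hypotheses (I1), (I2) for the gauged
family `c ⊙ W_t`), then the gauged twist `V = c ⊙ W_t` of some term satisfies `det V ≠ 0` and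
`n! · per(V ∘ V) ≤ B · B' · k · det(V)²` — the full "Forster modulo his Lemma" shape on the slice:
what is missing for the stub is a LEMMA producing such a gauge (or re-representation) with
`B · B' ≤ poly(k)`. [this file] -/
theorem forsterSlice_of_gauge_isotropic (n k : ℕ) (W : Fin k → Matrix (Fin n) (Fin n) ℝ)
    (c : Matrix (Fin n) (Fin n) ℝ) (hc : ∀ a i, 0 < c a i) (B B' : ℝ)
    (hrep : ∀ σ : Perm (Fin n), 0 < ((Perm.sign σ : ℤ) : ℝ) * ∑ t, ∏ i, W t (σ i) i)
    (hiso : ∑ t, (Matrix.of fun i j => (c ⊙ W t) i j ^ 2).permanent ≤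
      B * ∑ σ : Perm (Fin n), (∑ t, ∏ i, (c ⊙ W t) (σ i) i) ^ 2)
    (hflat : ∀ σ : Perm (Fin n), (n.factorial : ℝ) * (∑ t, ∏ i, (c ⊙ W t) (σ i) i) ^ 2 ≤
      B' * ∑ τ : Perm (Fin n), (∑ t, ∏ i, (c ⊙ W t) (τ i) i) ^ 2) :
    ∃ t : Fin k, (c ⊙ W t).det ≠ 0 ∧
      (n.factorial : ℝ) * (Matrix.of fun i j => (c ⊙ W t) i j ^ 2).permanent ≤
        B * B' * (k : ℝ) * (c ⊙ W t).det ^ 2 :=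
  forsterSlice_of_isotropic n k (fun t => c ⊙ W t) B B' (signRep_hadamard_of_pos W c hc hrep)
    hiso hflat

/-! ## §5 Isotropic representations are exponentially long -/

/-- **Length lower bound for isotropic sign-representations of `sgn`.**  If `k` real twists
sign-represent `sgn` on `S_n` in `(B, B')`-isotropic position ((I1), (I2)), then
`(n!)² ≤ nⁿ · (B · B' · k)`, i.e. `k · B · B' ≥ (n!)²/nⁿ ≥ n!/eⁿ`: Forster's inequality
(`forsterSlice_of_isotropic`) times the landed van der Waerden–Hadamard inequality
`n! · det(V)² ≤ nⁿ · per(V ∘ V)` (`stub_vdwHadamard`), cancelling `det(V)² > 0`.  Unconditional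
for this restricted model; says nothing about non-isotropic (cancelling) short representations, so
the crux `SrkNotQP` is not advanced. [this file] -/
theorem factorial_sq_le_of_isotropic_signRep (n k : ℕ) (W : Fin k → Matrix (Fin n) (Fin n) ℝ)
    (B B' : ℝ)
    (hrep : ∀ σ : Perm (Fin n), 0 < ((Perm.sign σ : ℤ) : ℝ) * ∑ t, ∏ i, W t (σ i) i)
    (hiso : ∑ t, (Matrix.of fun i j => W t i j ^ 2).permanent ≤
      B * ∑ σ : Perm (Fin n), (∑ t, ∏ i, W t (σ i) i) ^ 2)
    (hflat : ∀ σ : Perm (Fin n), (n.factorial : ℝ) * (∑ t, ∏ i, W t (σ i) i) ^ 2 ≤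
      B' * ∑ τ : Perm (Fin n), (∑ t, ∏ i, W t (τ i) i) ^ 2) :
    (n.factorial : ℝ) ^ 2 ≤ (n : ℝ) ^ n * (B * B' * (k : ℝ)) := by
  obtain ⟨t, hdet, h1⟩ := forsterSlice_of_isotropic n k W B B' hrep hiso hflat
  have h2 := SignRankSuperQP.stub_vdwHadamard n (W t)
  set Pm : ℝ := (Matrix.of fun i j => W t i j ^ 2).permanent with hPm
  have hd : 0 < (W t).det ^ 2 := by positivity
  have hf : (0 : ℝ) ≤ n.factorial := Nat.cast_nonneg _
  have hn : (0 : ℝ) ≤ (n : ℝ) ^ n := by positivity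
  have h3 : (n.factorial : ℝ) * ((n.factorial : ℝ) * (W t).det ^ 2) ≤
      (n.factorial : ℝ) * ((n : ℝ) ^ n * Pm) := mul_le_mul_of_nonneg_left h2 hf
  have h4 : (n : ℝ) ^ n * ((n.factorial : ℝ) * Pm) ≤
      (n : ℝ) ^ n * (B * B' * (k : ℝ) * (W t).det ^ 2) := mul_le_mul_of_nonneg_left h1 hn
  have h5 : (n.factorial : ℝ) ^ 2 * (W t).det ^ 2 ≤
      (n : ℝ) ^ n * (B * B' * (k : ℝ)) * (W t).det ^ 2 :=
    calc (n.factorial : ℝ) ^ 2 * (W t).det ^ 2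
        = (n.factorial : ℝ) * ((n.factorial : ℝ) * (W t).det ^ 2) := by ring
      _ ≤ (n.factorial : ℝ) * ((n : ℝ) ^ n * Pm) := h3
      _ = (n : ℝ) ^ n * ((n.factorial : ℝ) * Pm) := by ring
      _ ≤ (n : ℝ) ^ n * (B * B' * (k : ℝ) * (W t).det ^ 2) := h4
      _ = (n : ℝ) ^ n * (B * B' * (k : ℝ)) * (W t).det ^ 2 := by ring
  exact le_of_mul_le_mul_right h5 hd

end Summit.ValiantsHypothesis.ValiantsHypothesis.Theorems.SliceSignRank.SrkNotQP
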